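import Summits.BirchSwinnertonDyer.BirchSwinnertonDyer.Theorems.AlignedTransportAtTwoMainConjectureOfRankZeroBSDAtTwoCubicChevalleyUnitSignDoors
import Literature.NumberTheory.EllipticCurves.TwoSelmerCubicTwoTorsionFieldClassGroup
import Summits.BirchSwinnertonDyer.BirchSwinnertonDyer.Theorems.ByReductionTypeAtTwoAnalyticMuZeroAtTwoHolds
import HarnessLib

/-!
# Route `AlignedTransportAtTwo`, crux C2 `MainConjectureOfRankZeroBSDAtTwo` (stmt-BirchSwinnertonDyer-22298):
# THE CLASS-NUMBER BIT OF CHEVALLEY'S DOOR IS A `2`-SELMER BIT — with the printed Brumer–Kramer / Yoo–Yu bound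
# `dim C_{ℚ(β)}[2] ≤ dim Sel₂(W/ℚ)` the cubic `(0,1)`-Chevalley road OFF the stratum displays NO class-group datum at all:
# PRINT⁶ + MuIneqʳ + `Sel₂(W/ℚ) = 0` + odd Tamagawa product + the integer certificates of one unit of `ℚ(β)`

HONEST FRAMING (cell `bsd-f1-sign2`, WIDTH-5 attached prover seat `bsd-line-att-p5` gen 29 on line `birth` of the lead `bsd-line-att-p2`;
`--supports` stmt-BirchSwinnertonDyer-22298, closes nothing; BSD is NOT proved by any of this; the crux C2, its verdict «blocked-on
`Rank1Residual.GreenbergMuConjectureIrreducible`» and every registered stub are untouched). THEOREMS ONLY here; the ONE NAMED FACT they display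
(published theorem, statement only, cited) is `Literature.NumberTheory.EllipticCurves.yooYu_selmerTwo_eq_bot_oddClassNumber_cubicTwoTorsionField`
(file `Literature/NumberTheory/EllipticCurves/TwoSelmerCubicTwoTorsionFieldClassGroup.lean`, this gen); no `sorry`. Sequel of `…CubicChevalleyUnitSignDoors` (att-p5 g29):
there the off-stratum door into `MC₂(W)` displays, besides PRINT⁵ + MuIneqʳ and integer certificates, exactly ONE non-integer datum — `2 ∤ h(ℚ(β))`.
That bit is governed by the curve's own `2`-descent: Brumer–Kramer 1977 §7 / Li 2019 Thm. 1.1 / Barrera–Pacetti–Tornaría 2021 / **Yoo–Yu 2022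
Thm. 1.6 with Thm. 1.10 and Thm. 1.11 (1)** give `dim_𝔽₂ C_L[2] ≤ dim_𝔽₂ Sel₂(E/ℚ) ≤ dim_𝔽₂ C_L[2] + 1` for `L` the cubic `2`-torsion field whenever
`E` is good ORDINARY at `2` and its Tamagawa numbers at odd primes are odd (`L` complex cubic, so semi-narrow = narrow = ordinary class group).
The cell knows this print on the `Δ > 0`, rank-one slice (REF2 v16 §44, v47 §13.3; `F1Sign2/ModularDegreeCubicFieldAtTwo` S38d/e); here it is
PLACED on the C2 cubic road (`Δ_W < 0`, rank zero) in the special shape the doors consume: **`Sel₂(W/ℚ) = 0 ⟹ 2 ∤ h(ℚ(β))`**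
(the named fact, hypothesis `hYY`).

WHAT.
* **`classicalMuVanishes_adjoin_of_selmerTwo_eq_bot_of_unitCerts_of_not_onKilfordStratumAtTwo`**: `μ₂(ℚ(β)^cyc) = 0` OFF the stratum from
  the fact + `Sel₂(W/ℚ) = ⊥` + `Odd (∏_v c_v)` + the unit's integer certificates.
* **`mazurMainConjecture_two_of_muIneqRel_of_selmerTwo_eq_bot_of_unitCerts_of_not_onKilfordStratumAtTwo`**: `MC₂(W)` ⟸ PRINT⁵ + `hYY` + MuIneqʳ
  (registered stub verbatim) + cell hypotheses (`Δ_W < 0`) + OFF the stratum + `Sel₂(W/ℚ) = ⊥` + `Odd (∏_v c_v)` + integers;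
  **`…_muFree`**: the same with the crux's analytic-`μ` hypothesis `hμan` DISCHARGED (bsd-2adic `AnalyticMuTwo.red_ne_zero_…`).

READING. On the cell `Sel₂(W/ℚ) = ⊥` is `rank E_W(ℚ) = 0 ∧ Ш(W)[2] = 0` (`E_W(ℚ)[2] = 0`; tree fact `selmer_exact`, bsd.S11), and under the crux's
own `BSD₂(W)` with `r_an = 0` it is «`ord₂ #Ш_an(W) = 0`», i.e. `L(W,1)/Ω_W` is a `2`-adic unit when all `c_v` and `#E_W(ℚ)_tors` are odd.
Example: 2045b1 has `#Ш_an = 16` (cell table X5-AT2 v1.2), so BSD₂ and the two-sided bound force `2 ∣ h(ℚ(β))` there — its `(0,1)` class-number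
rows can never fire (prediction for -data). CONDITIONAL theorems (PRINT⁵, `hYY`, MuIneqʳ displayed); nothing is asserted about any curve;
nothing is closed; BSD is not proved.

References: [YooYu2022] Thm. 1.4, 1.6, 1.10, 1.11 (1), §1 (semi-narrow = narrow for totally negative discriminant); [BrumerKramer1977] §7;
[Li2019SelmerClassGroups] Thm. 1.1; [BarrerasalazarPacettiTornaria2021] Thm. 1.7; tree: att-p5 g29 `…CubicChevalleyUnitSignDoors`,
`Literature/NumberTheory/EllipticCurves/{Selmer,BSDSelmer,Tamagawa}.lean`.
-/

set_option linter.dupNamespace false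
set_option autoImplicit false

noncomputable section

open scoped Classical NumberField nonZeroDivisors IntermediateField

namespace Summit.BirchSwinnertonDyer.BirchSwinnertonDyer.Theorems.AlignedTransportAtTwoCubicChevalleySelmerBit

open NumberField IsDedekindDomain Polynomial WeierstrassCurve IntermediateField CongruenceSubgroup
  Literature.NumberTheory.IwasawaTheory Literature.NumberTheory.GaloisRepresentations
  Literature.NumberTheory.EllipticCurves Literature.NumberTheory.EllipticCurves.Greenberg1999
  Literature.NumberTheory.EllipticCurves.ModularForms Literature.NumberTheory.EllipticCurves.Rank1Residual
  Literature.NumberTheory.EllipticCurves.Module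
  Summit.BirchSwinnertonDyer.Rank1Residual Summit.BirchSwinnertonDyer.Rank1Residual.X1.MuLambda
  Summit.BirchSwinnertonDyer.Rank1Residual.X5 Summit.BirchSwinnertonDyer.Rank1Residual.F1Sign2
  Summit.BirchSwinnertonDyer.BirchSwinnertonDyer.Theorems.Rank1ResidualX1Defs
  Summit.BirchSwinnertonDyer.BirchSwinnertonDyer.Theses.AlignedTransportAtTwo
  Summit.BirchSwinnertonDyer.BirchSwinnertonDyer.Theorems.AlignedTransportAtTwoCubicChevalleyUnitSignDoors

/-! ## The class-group-free doors (the named fact `yooYu_selmerTwo_eq_bot_oddClassNumber_cubicTwoTorsionField` lives in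
`Literature/NumberTheory/EllipticCurves/TwoSelmerCubicTwoTorsionFieldClassGroup.lean`) -/

variable (W : WeierstrassCurve ℚ) [W.IsElliptic] [W.IsGloballyMinimal]

/-- **`μ₂(ℚ(β)^{cyc}) = 0` OFF THE STRATUM WITH NO CLASS-GROUP DATUM.** Yoo–Yu/Brumer–Kramer (`hYY`) + `Sel₂(W/ℚ) = ⊥` + `Odd (∏_v c_v)` discharge
`2 ∤ h(ℚ(β))`; the unit `ε = P(4β)/(2^k m)` with its cubic unit equation and `2`-adic sign certificate (integers) discharges the unit bit
(`…UnitSignDoors.classicalMuVanishes_adjoin_of_unitCerts_of_not_onKilfordStratumAtTwo`). [cite: YooYu2022, Thm. 1.6 with Thm. 1.10 and 1.11]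
[cite: Lang1990, Ch. 13 §4, Lemma 4.1] [cite: Fukuda1994, Thm. 1 (1), p. 264] [cite: Serre1973, Ch. III §1.2 Thm. 1] -/
theorem classicalMuVanishes_adjoin_of_selmerTwo_eq_bot_of_unitCerts_of_not_onKilfordStratumAtTwo
    (hYY : yooYu_selmerTwo_eq_bot_oddClassNumber_cubicTwoTorsionField)
    (hord : IsOrdinaryAt W 2) (ht : ∀ x : ℚ, ¬ HasRationalTwoTorsionX W x) (hΔ : W.Δ < 0) (hs : ¬ OnKilfordStratumAtTwo W)
    (htam : Odd W.tamagawaProduct) (hSel : W.selmerGroup 2 = ⊥)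
    {β : AlgebraicClosure ℚ} (hβ : aeval β W.twoTorsionPolynomial.toPoly = 0)
    (P : ℤ[X]) (k : ℕ) (m m' a c T S sgn : ℤ) (hsgn : sgn = 1 ∨ sgn = -1)
    (hid : (aeval (4 * (AdjoinSimple.gen ℚ β : ↥(IntermediateField.adjoin ℚ ({β} : Set (AlgebraicClosure ℚ)))))
          (P.map (Int.castRingHom ℚ)) / (2 ^ k * (m : ↥(IntermediateField.adjoin ℚ ({β} : Set (AlgebraicClosure ℚ)))))) ^ 3
        - T * (aeval (4 * (AdjoinSimple.gen ℚ β : ↥(IntermediateField.adjoin ℚ ({β} : Set (AlgebraicClosure ℚ)))))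
          (P.map (Int.castRingHom ℚ)) / (2 ^ k * (m : ↥(IntermediateField.adjoin ℚ ({β} : Set (AlgebraicClosure ℚ)))))) ^ 2
        + S * (aeval (4 * (AdjoinSimple.gen ℚ β : ↥(IntermediateField.adjoin ℚ ({β} : Set (AlgebraicClosure ℚ)))))
          (P.map (Int.castRingHom ℚ)) / (2 ^ k * (m : ↥(IntermediateField.adjoin ℚ ({β} : Set (AlgebraicClosure ℚ))))))
        - sgn = 0)
    (hc : c = 3 ∨ c = 5) (ha : Odd a)
    (hroot : (2 : ℤ) ^ (k + 3) ∣
      a ^ 3 + (integralModelInt W).b₂ * a ^ 2 + 8 * (integralModelInt W).b₄ * a + 16 * (integralModelInt W).b₆)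
    (hmm : ((m * m' : ℤ) : ZMod (2 ^ 3)) = 1)
    (hcert : ((P.eval a * m' : ℤ) : ZMod (2 ^ (k + 3))) = ((2 ^ k * c : ℤ) : ZMod (2 ^ (k + 3))))
    (κP : ZpExtension ↥(IntermediateField.adjoin ℚ ({β} : Set (AlgebraicClosure ℚ))) 2) (hκP : κP.IsCyclotomic) :
    ClassicalMuVanishes κP := by
  have hh0 := hYY W hord ht hΔ htam hSel hβ
  have hβint : IsIntegral ℚ β := ((AlgebraicClosure.isAlgebraic ℚ).isAlgebraic β).isIntegral
  haveI : FiniteDimensional ℚ ↥(IntermediateField.adjoin ℚ ({β} : Set (AlgebraicClosure ℚ))) :=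
    IntermediateField.adjoin.finiteDimensional hβint
  haveI : NumberField ↥(IntermediateField.adjoin ℚ ({β} : Set (AlgebraicClosure ℚ))) := NumberField.mk
  refine classicalMuVanishes_adjoin_of_unitCerts_of_not_onKilfordStratumAtTwo W hord ht hs hβ ?_ P k m m' a c T S sgn hsgn hid hc ha
    hroot hmm hcert κP hκP
  rw [NumberField.classNumber, ← Nat.card_eq_fintype_card]
  exact hh0

/-- **THE CLASS-GROUP-FREE OFF-STRATUM DOOR INTO `MC₂(W)`.** PRINT⁵ {Kato 17.4 (1)(2) at `2`, Greenberg 4.1, period unit, modularity, GZK} +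
Yoo–Yu/Brumer–Kramer (`hYY`) + MuIneqʳ (`hI`, the registered stub VERBATIM) + the cell hypotheses (good ordinary at `2`, no rational `2`-torsion
abscissa, `Δ_W < 0`, `r_an = 0`, analytic `μ₂ = 0` on the even branch, `BSD₂(W)`) + OFF the Kilford stratum + **`Sel₂(W/ℚ) = ⊥`** + **`Odd (∏_v c_v)`** +
`β` a root of the `2`-division cubic + the INTEGER certificates `(P, k, m, m', a, c, T, S, sgn)` of one unit of `ℚ(β)` ⟹ `MC₂(W)`. No class group,
no unit given as data beyond integers. [cite: YooYu2022, Thm. 1.6 with Thm. 1.10 and 1.11] [cite: Kato2004Asterisque, Thm. 17.4 (1)(2) (p. 273)]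
[cite: GreenbergLNM1716, Thm. 4.1 (p. 102) and Conj. 1.11 (p. 58)] [cite: Fukuda1994, Thm. 1 (1), p. 264] [cite: Lang1990, Ch. 13 §4, Lemma 4.1]
[cite: Serre1973, Ch. III §1.2 Thm. 1] -/
theorem mazurMainConjecture_two_of_muIneqRel_of_selmerTwo_eq_bot_of_unitCerts_of_not_onKilfordStratumAtTwo
    (h17 : ∀ [NeZero (W.conductorNorm ℤ)] (f : CuspForm (Gamma0 (W.conductorNorm ℤ)) 2),
      kato_divisibility_allPrimes W 2 (f := f))
    (hGr : Greenberg1999.thm41_charValue_rankZero_anyPrime)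
    (hper : realPeriodRat_eq_unit_mul_plusPeriod_two) (hmod : nonempty_modularParametrizationData)
    (hGZK : rank_eq_analyticRank_of_analyticRank_le_one)
    (hYY : yooYu_selmerTwo_eq_bot_oddClassNumber_cubicTwoTorsionField)
    (hI : ∀ (W : WeierstrassCurve ℚ) [W.IsElliptic] [W.IsGloballyMinimal], IsOrdinaryAt W 2 →
      (∀ x : ℚ, ¬ HasRationalTwoTorsionX W x) →
      ∀ (κ : ZpExtension ℚ 2) (γ : Field.absoluteGaloisGroup ℚ), κ.IsCyclotomic →
      κ.IsTopGenerator γ → IsCyclotomicVariable 2 γ →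
      ∀ ⦃N : ℕ⦄ [NeZero N] (f : CuspForm (Gamma0 N) 2), IsNewformOf W f →
      ∀ Gp : IwasawaAlgebra 2, iwasawaToPowerSeries 2 Gp = padicLFunction f (unitRoot W 2 : ℚ_[2]) →
      ∀ (D : W.SelmerDualData κ γ) (Yr : W.FineSelmerDualDataRelaxedInf κ γ),
        lengthAt (IwasawaAlgebra 2) D.X ⟨IwasawaAlgebra.augIdealP 2, IwasawaAlgebra.isPrime_augIdealP_holds 2⟩ ≤
          lengthAt (IwasawaAlgebra 2) (IwasawaAlgebra 2 ⧸ Ideal.span {Gp})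
              ⟨IwasawaAlgebra.augIdealP 2, IwasawaAlgebra.isPrime_augIdealP_holds 2⟩ +
            lengthAt (IwasawaAlgebra 2) Yr.X ⟨IwasawaAlgebra.augIdealP 2, IwasawaAlgebra.isPrime_augIdealP_holds 2⟩)
    (hord : IsOrdinaryAt W 2) (ht : ∀ x : ℚ, ¬ HasRationalTwoTorsionX W x) (hΔ : W.Δ < 0) (hr : W.analyticRank = 0)
    (hμan : ∀ ⦃N : ℕ⦄ [NeZero N] (f : CuspForm (Gamma0 N) 2), IsNewformOf W f →
      ∀ G : IwasawaAlgebra 2, IsEvenBranchLiftAtTwo W f G → red G ≠ 0)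
    (hbsd : BSDp W 2) (hs : ¬ OnKilfordStratumAtTwo W) (htam : Odd W.tamagawaProduct) (hSel : W.selmerGroup 2 = ⊥)
    {β : AlgebraicClosure ℚ} (hβ : aeval β W.twoTorsionPolynomial.toPoly = 0)
    (P : ℤ[X]) (k : ℕ) (m m' a c T S sgn : ℤ) (hsgn : sgn = 1 ∨ sgn = -1)
    (hid : (aeval (4 * (AdjoinSimple.gen ℚ β : ↥(IntermediateField.adjoin ℚ ({β} : Set (AlgebraicClosure ℚ)))))
          (P.map (Int.castRingHom ℚ)) / (2 ^ k * (m : ↥(IntermediateField.adjoin ℚ ({β} : Set (AlgebraicClosure ℚ)))))) ^ 3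
        - T * (aeval (4 * (AdjoinSimple.gen ℚ β : ↥(IntermediateField.adjoin ℚ ({β} : Set (AlgebraicClosure ℚ)))))
          (P.map (Int.castRingHom ℚ)) / (2 ^ k * (m : ↥(IntermediateField.adjoin ℚ ({β} : Set (AlgebraicClosure ℚ)))))) ^ 2
        + S * (aeval (4 * (AdjoinSimple.gen ℚ β : ↥(IntermediateField.adjoin ℚ ({β} : Set (AlgebraicClosure ℚ)))))
          (P.map (Int.castRingHom ℚ)) / (2 ^ k * (m : ↥(IntermediateField.adjoin ℚ ({β} : Set (AlgebraicClosure ℚ))))))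
        - sgn = 0)
    (hc : c = 3 ∨ c = 5) (ha : Odd a)
    (hroot : (2 : ℤ) ^ (k + 3) ∣
      a ^ 3 + (integralModelInt W).b₂ * a ^ 2 + 8 * (integralModelInt W).b₄ * a + 16 * (integralModelInt W).b₆)
    (hmm : ((m * m' : ℤ) : ZMod (2 ^ 3)) = 1)
    (hcert : ((P.eval a * m' : ℤ) : ZMod (2 ^ (k + 3))) = ((2 ^ k * c : ℤ) : ZMod (2 ^ (k + 3)))) :
    MazurMainConjecture W 2 := by
  have hh0 := hYY W hord ht hΔ htam hSel hβ
  have hβint : IsIntegral ℚ β := ((AlgebraicClosure.isAlgebraic ℚ).isAlgebraic β).isIntegral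
  haveI : FiniteDimensional ℚ ↥(IntermediateField.adjoin ℚ ({β} : Set (AlgebraicClosure ℚ))) :=
    IntermediateField.adjoin.finiteDimensional hβint
  haveI : NumberField ↥(IntermediateField.adjoin ℚ ({β} : Set (AlgebraicClosure ℚ))) := NumberField.mk
  refine mazurMainConjecture_two_of_muIneqRel_of_unitCerts_of_not_onKilfordStratumAtTwo W h17 hGr hper hmod hGZK hI hord ht hΔ hr hμan
    hbsd hs hβ ?_ P k m m' a c T S sgn hsgn hid hc ha hroot hmm hcert
  rw [NumberField.classNumber, ← Nat.card_eq_fintype_card]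
  exact hh0


/-- **THE CLASS-GROUP-FREE OFF-STRATUM DOOR, `hμan`-FREE.** The same with the analytic `μ₂ = 0` hypothesis of the crux DISCHARGED by bsd-2adic's
theorem `AnalyticMuTwo.red_ne_zero_of_isEvenBranchLiftAtTwo_of_forall_not_hasRationalTwoTorsionX` (good ordinary at `2`, no rational `2`-torsion
abscissa ⟹ every even-branch lift has odd reduction). Displayed: PRINT⁵ + `hYY` + MuIneqʳ + cell binders (`hord`, `ht`, `hΔ`, `hr`, `hbsd`) + OFF the
stratum + `Sel₂(W/ℚ) = ⊥` + `Odd (∏_v c_v)` + integers. [cite: YooYu2022, Thm. 1.6 with Thm. 1.10 and 1.11] [cite: Kato2004Asterisque, Thm. 17.4 (1)(2) (p. 273)]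
[cite: GreenbergLNM1716, Thm. 4.1 (p. 102) and Conj. 1.11 (p. 58)] [cite: Fukuda1994, Thm. 1 (1), p. 264] [cite: Lang1990, Ch. 13 §4, Lemma 4.1] -/
theorem mazurMainConjecture_two_of_muIneqRel_of_selmerTwo_eq_bot_of_unitCerts_muFree
    (h17 : ∀ [NeZero (W.conductorNorm ℤ)] (f : CuspForm (Gamma0 (W.conductorNorm ℤ)) 2),
      kato_divisibility_allPrimes W 2 (f := f))
    (hGr : Greenberg1999.thm41_charValue_rankZero_anyPrime)
    (hper : realPeriodRat_eq_unit_mul_plusPeriod_two) (hmod : nonempty_modularParametrizationData)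
    (hGZK : rank_eq_analyticRank_of_analyticRank_le_one)
    (hYY : yooYu_selmerTwo_eq_bot_oddClassNumber_cubicTwoTorsionField)
    (hI : ∀ (W : WeierstrassCurve ℚ) [W.IsElliptic] [W.IsGloballyMinimal], IsOrdinaryAt W 2 →
      (∀ x : ℚ, ¬ HasRationalTwoTorsionX W x) →
      ∀ (κ : ZpExtension ℚ 2) (γ : Field.absoluteGaloisGroup ℚ), κ.IsCyclotomic →
      κ.IsTopGenerator γ → IsCyclotomicVariable 2 γ →
      ∀ ⦃N : ℕ⦄ [NeZero N] (f : CuspForm (Gamma0 N) 2), IsNewformOf W f →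
      ∀ Gp : IwasawaAlgebra 2, iwasawaToPowerSeries 2 Gp = padicLFunction f (unitRoot W 2 : ℚ_[2]) →
      ∀ (D : W.SelmerDualData κ γ) (Yr : W.FineSelmerDualDataRelaxedInf κ γ),
        lengthAt (IwasawaAlgebra 2) D.X ⟨IwasawaAlgebra.augIdealP 2, IwasawaAlgebra.isPrime_augIdealP_holds 2⟩ ≤
          lengthAt (IwasawaAlgebra 2) (IwasawaAlgebra 2 ⧸ Ideal.span {Gp})
              ⟨IwasawaAlgebra.augIdealP 2, IwasawaAlgebra.isPrime_augIdealP_holds 2⟩ +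
            lengthAt (IwasawaAlgebra 2) Yr.X ⟨IwasawaAlgebra.augIdealP 2, IwasawaAlgebra.isPrime_augIdealP_holds 2⟩)
    (hord : IsOrdinaryAt W 2) (ht : ∀ x : ℚ, ¬ HasRationalTwoTorsionX W x) (hΔ : W.Δ < 0) (hr : W.analyticRank = 0)
    (hbsd : BSDp W 2) (hs : ¬ OnKilfordStratumAtTwo W) (htam : Odd W.tamagawaProduct) (hSel : W.selmerGroup 2 = ⊥)
    {β : AlgebraicClosure ℚ} (hβ : aeval β W.twoTorsionPolynomial.toPoly = 0)
    (P : ℤ[X]) (k : ℕ) (m m' a c T S sgn : ℤ) (hsgn : sgn = 1 ∨ sgn = -1)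
    (hid : (aeval (4 * (AdjoinSimple.gen ℚ β : ↥(IntermediateField.adjoin ℚ ({β} : Set (AlgebraicClosure ℚ)))))
          (P.map (Int.castRingHom ℚ)) / (2 ^ k * (m : ↥(IntermediateField.adjoin ℚ ({β} : Set (AlgebraicClosure ℚ)))))) ^ 3
        - T * (aeval (4 * (AdjoinSimple.gen ℚ β : ↥(IntermediateField.adjoin ℚ ({β} : Set (AlgebraicClosure ℚ)))))
          (P.map (Int.castRingHom ℚ)) / (2 ^ k * (m : ↥(IntermediateField.adjoin ℚ ({β} : Set (AlgebraicClosure ℚ)))))) ^ 2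
        + S * (aeval (4 * (AdjoinSimple.gen ℚ β : ↥(IntermediateField.adjoin ℚ ({β} : Set (AlgebraicClosure ℚ)))))
          (P.map (Int.castRingHom ℚ)) / (2 ^ k * (m : ↥(IntermediateField.adjoin ℚ ({β} : Set (AlgebraicClosure ℚ))))))
        - sgn = 0)
    (hc : c = 3 ∨ c = 5) (ha : Odd a)
    (hroot : (2 : ℤ) ^ (k + 3) ∣
      a ^ 3 + (integralModelInt W).b₂ * a ^ 2 + 8 * (integralModelInt W).b₄ * a + 16 * (integralModelInt W).b₆)
    (hmm : ((m * m' : ℤ) : ZMod (2 ^ 3)) = 1)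
    (hcert : ((P.eval a * m' : ℤ) : ZMod (2 ^ (k + 3))) = ((2 ^ k * c : ℤ) : ZMod (2 ^ (k + 3)))) :
    MazurMainConjecture W 2 :=
  mazurMainConjecture_two_of_muIneqRel_of_selmerTwo_eq_bot_of_unitCerts_of_not_onKilfordStratumAtTwo W h17 hGr hper hmod hGZK hYY hI hord
    ht hΔ hr (AnalyticMuTwo.red_ne_zero_of_isEvenBranchLiftAtTwo_of_forall_not_hasRationalTwoTorsionX W hord ht) hbsd hs htam hSel hβ P k m
    m' a c T S sgn hsgn hid hc ha hroot hmm hcert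

end Summit.BirchSwinnertonDyer.BirchSwinnertonDyer.Theorems.AlignedTransportAtTwoCubicChevalleySelmerBit

end
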